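import Mathlib.Analysis.SpecialFunctions.ImproperIntegrals
import Mathlib.MeasureTheory.Integral.DominatedConvergence
import Mathlib.MeasureTheory.Integral.Prod
import Literature.NumberTheory.LFunctions.WeilExplicit
import Literature.NumberTheory.LFunctions.WeilMellinBounds
import Literature.NumberTheory.LFunctions.WeilMellinInversion
import Literature.MathematicalPhysics.QuantumLattice.FreeCovarianceProofs
import HarnessLib

/-!
# The smeared window formula (`stub_smearedWindowFormula`)

Stub `stub_smearedWindowFormula` of the line `causal-level-sets` for the crux `WindowTraceArch`
(stmt-RiemannHypothesis-11195; skeleton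
`Summit.RiemannHypothesis.RiemannHypothesis.Cruxes.WindowTraceArch.CausalLevelSets`).

**Statement.** Let `γ, b : ℕ → ℝ` be a configuration with widths `δ ≤ b k ≤ B` (`δ > 0`) and
`Σ_k 1/(1 + γ_k²) < ∞`, let `L` be any real number and `h` a Weil test
(`Literature.NumberTheory.LFunctions.IsWeilTest`: smooth of compact support), with transform
`ĥ(s) = weilMellin h s` (so that `ĥ(1/2 + it) = ∫ h(x) e^{itx} dx`). Then
`Σ_k ∫ h(x) e^{iγ_k x} e^{-b_k|x|} dx
  = (1/π) ∫ ĥ(1/2 + it) (L + Σ_k b_k/((t - γ_k)² + b_k²)) dt - 2L h(0)`,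
the series on the left converging (`HasSum`) to the right-hand side.

**Proof.**
* One atom (`stub_smearedWindowFormula_atom`): the Poisson kernel is a Fourier integral,
  `b/((t-γ)²+b²) = (1/2) ∫ e^{-i(t-γ)x} e^{-b|x|} dx` (the transform of `e^{-b|x|}`,
  `Literature.MathematicalPhysics.QuantumLattice.fourier_exp_neg_mul_abs`, at the frequency
  `(t-γ)/2π`; `stub_smearedWindowFormula_kernel`); Fubini (the integrand is dominated by the
  product of the integrable functions `‖ĥ(1/2+it)‖` and `e^{-b|x|}`) and Mellin inversion on the
  critical line, `∫ ĥ(1/2+it) e^{-itx} dt = 2π h(x)` (`weilMellin_inversion`), give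
  `∫ ĥ(1/2+it) b/((t-γ)²+b²) dt = π ∫ h(x) e^{iγx} e^{-b|x|} dx`.
* The `L`-term: `∫ ĥ(1/2+it) dt = 2π h(0)` (`integral_weilMellin_vertical`), so it cancels
  against `-2L h(0)`.
* The series: Peetre's inequality `1 + γ² ≤ 2(1+t²)(1+(t-γ)²)` gives
  `b_k/((t-γ_k)²+b_k²) ≤ 2B(1+δ⁻²)(1+t²)/(1+γ_k²)` (`stub_smearedWindowFormula_poisson_le`), so the
  kernels are summable for each `t` with sum `≤ C(1+t²)`; two integrations by parts
  (`weilMellin_deriv_deriv`, `norm_weilMellin_le` for `h` and `h''`) give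
  `(1+t²)‖ĥ(1/2+it)‖ ≤ C'/(1+t²)` (`stub_smearedWindowFormula_decay`); dominated convergence for
  series (`MeasureTheory.hasSum_integral_of_dominated_convergence`) with the integrable majorant
  `C C'(1+t²)⁻¹ Σ_k 1/(1+γ_k²)`-weighted terms exchanges `Σ_k` and `∫ dt` and yields the `HasSum`.
  Measurability of `t ↦ Σ_k b_k/((t-γ_k)²+b_k²)` is that of a pointwise limit of finite sums.

**Sources.** Standard Fourier analysis: the Poisson kernel / Cauchy distribution as the Fourier
transform of `e^{-b|x|}` (E. M. Stein, G. Weiss, *Introduction to Fourier Analysis on Euclidean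
Spaces* (1971), Ch. I, §1, the Poisson kernel), Fourier inversion for smooth compactly supported
functions, Fubini and dominated convergence. All ingredients are proved tree / Mathlib facts.
-/

set_option linter.dupNamespace false

noncomputable section

open Complex Set MeasureTheory Filter
open scoped Real Topology

namespace Summit.RiemannHypothesis.RiemannHypothesis.Theorems.SpectralTraceWindowTraceArch

open Literature.NumberTheory.LFunctions
open Literature.MathematicalPhysics.QuantumLattice (fourier_exp_neg_mul_abs
  integrable_exp_neg_mul_abs)

/-- Peetre's inequality in the form `1 + γ² ≤ 2 (1 + t²) (1 + (t - γ)²)`. -/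
theorem stub_smearedWindowFormula_peetre (t γ : ℝ) :
    1 + γ ^ 2 ≤ 2 * (1 + t ^ 2) * (1 + (t - γ) ^ 2) := by
  nlinarith [sq_nonneg (2 * t - γ), sq_nonneg (t * (t - γ))]

/-- The Poisson kernel of a configuration point is non-negative. -/
theorem stub_smearedWindowFormula_poisson_nonneg {b : ℝ} (hb : 0 ≤ b) (t γ : ℝ) :
    0 ≤ b / ((t - γ) ^ 2 + b ^ 2) := by
  positivity

/-- The Poisson kernels of a configuration with widths `δ ≤ b ≤ B` are bounded by
`2B(1 + δ⁻²) (1 + t²)/(1 + γ²)` (Peetre's inequality). -/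
theorem stub_smearedWindowFormula_poisson_le {δ B b : ℝ} (hδ : 0 < δ) (hδb : δ ≤ b)
    (hbB : b ≤ B) (t γ : ℝ) :
    b / ((t - γ) ^ 2 + b ^ 2) ≤ 2 * B * (1 + (δ ^ 2)⁻¹) * (1 + t ^ 2) / (1 + γ ^ 2) := by
  have hb : 0 < b := hδ.trans_le hδb
  have hB : 0 ≤ B := hb.le.trans hbB
  have hD : 0 < (t - γ) ^ 2 + b ^ 2 := by positivity
  have hD' : 0 < (t - γ) ^ 2 + δ ^ 2 := by positivity
  have h1 : b / ((t - γ) ^ 2 + b ^ 2) ≤ B / ((t - γ) ^ 2 + δ ^ 2) := by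
    rw [div_le_div_iff₀ hD hD']
    have h2 : δ ^ 2 ≤ b ^ 2 := by gcongr
    nlinarith [sq_nonneg (t - γ), mul_le_mul_of_nonneg_right hbB (sq_nonneg (t - γ)),
      mul_le_mul_of_nonneg_left h2 hb.le, mul_le_mul_of_nonneg_right hbB (sq_nonneg b)]
  have h3 : 1 / ((t - γ) ^ 2 + δ ^ 2) ≤ (1 + (δ ^ 2)⁻¹) / (1 + (t - γ) ^ 2) := by
    rw [div_le_div_iff₀ hD' (by positivity)]
    have : (δ ^ 2)⁻¹ * δ ^ 2 = 1 := inv_mul_cancel₀ (by positivity)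
    nlinarith [mul_nonneg (inv_nonneg.2 (sq_nonneg δ)) (sq_nonneg (t - γ))]
  have h4 : 1 / (1 + (t - γ) ^ 2) ≤ 2 * (1 + t ^ 2) / (1 + γ ^ 2) := by
    rw [div_le_div_iff₀ (by positivity) (by positivity)]
    nlinarith [stub_smearedWindowFormula_peetre t γ]
  calc b / ((t - γ) ^ 2 + b ^ 2) ≤ B / ((t - γ) ^ 2 + δ ^ 2) := h1
    _ = B * (1 / ((t - γ) ^ 2 + δ ^ 2)) := by ring
    _ ≤ B * ((1 + (δ ^ 2)⁻¹) / (1 + (t - γ) ^ 2)) := mul_le_mul_of_nonneg_left h3 hB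
    _ = B * (1 + (δ ^ 2)⁻¹) * (1 / (1 + (t - γ) ^ 2)) := by ring
    _ ≤ B * (1 + (δ ^ 2)⁻¹) * (2 * (1 + t ^ 2) / (1 + γ ^ 2)) :=
        mul_le_mul_of_nonneg_left h4 (by positivity)
    _ = 2 * B * (1 + (δ ^ 2)⁻¹) * (1 + t ^ 2) / (1 + γ ^ 2) := by ring

/-- Decay of the transform of a Weil test on the critical line:
`(1 + t²) ‖ĥ(1/2 + it)‖ ≤ (C_h + C_{h''})/(1 + t²)`. -/
theorem stub_smearedWindowFormula_decay {h : ℝ → ℂ} (hh : IsWeilTest h) (t : ℝ) :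
    (1 + t ^ 2) * ‖weilMellin h (1 / 2 + (t : ℂ) * I)‖ ≤
      (weilDecayConst h + weilDecayConst (deriv (deriv h))) / (1 + t ^ 2) := by
  have hs0 : (0 : ℝ) ≤ (1 / 2 + (t : ℂ) * I).re := by simp
  have hs1 : (1 / 2 + (t : ℂ) * I).re ≤ 1 := by simp; norm_num
  have him : (1 / 2 + (t : ℂ) * I).im = t := by simp
  have h1 := norm_weilMellin_le hh hs0 hs1
  have h2 := norm_weilMellin_le hh.deriv.deriv hs0 hs1
  rw [weilMellin_deriv_deriv hh, norm_mul, him] at h2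
  rw [him] at h1
  have h3 : ‖((1 : ℂ) / 2 + (t : ℂ) * I - 1 / 2) ^ 2‖ = t ^ 2 := by
    rw [add_sub_cancel_left, norm_pow, norm_mul, Complex.norm_real, Complex.norm_I, mul_one,
      Real.norm_eq_abs, sq_abs]
  rw [h3] at h2
  rw [add_div, add_mul, one_mul]
  exact add_le_add h1 h2

/-- The Poisson kernel as a Fourier integral: for `b > 0`,
`∫ e^{-i(t-γ)x} e^{-b|x|} dx = 2b/((t-γ)² + b²)` (the transform of `e^{-b|x|}`,
`fourier_exp_neg_mul_abs`, evaluated at the frequency `(t-γ)/2π`). -/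
theorem stub_smearedWindowFormula_kernel {b : ℝ} (hb : 0 < b) (γ t : ℝ) :
    ∫ x : ℝ, cexp ((((-((t - γ) * x)) : ℝ) : ℂ) * I) * ((Real.exp (-(b * |x|)) : ℝ) : ℂ) =
      (((2 * b / ((t - γ) ^ 2 + b ^ 2)) : ℝ) : ℂ) := by
  have key := congrFun (fourier_exp_neg_mul_abs hb) ((t - γ) / (2 * π))
  rw [Real.fourier_real_eq_integral_exp_smul] at key
  simp only [smul_eq_mul] at key
  have e1 : ∀ v : ℝ, -2 * π * v * ((t - γ) / (2 * π)) = -((t - γ) * v) := by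
    intro v; field_simp
  have e2 : (2 * π * ((t - γ) / (2 * π))) ^ 2 + b ^ 2 = (t - γ) ^ 2 + b ^ 2 := by
    field_simp
  simp_rw [e1] at key
  rw [e2] at key
  exact key

/-- **One smeared atom.** For a Weil test `h`, `b > 0` and real `γ`:
`∫ h(x) e^{iγx} e^{-b|x|} dx = (1/π) ∫ ĥ(1/2+it) · b/((t-γ)²+b²) dt` — the Poisson kernel is
`(1/2)∫ e^{-i(t-γ)x} e^{-b|x|} dx` (`stub_smearedWindowFormula_kernel`), Fubini, and Mellin
inversion `∫ ĥ(1/2+it) e^{-itx} dt = 2π h(x)` (`weilMellin_inversion`). -/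
theorem stub_smearedWindowFormula_atom {h : ℝ → ℂ} (hh : IsWeilTest h) {b : ℝ} (hb : 0 < b)
    (γ : ℝ) :
    ∫ x : ℝ, h x * cexp (((γ * x : ℝ) : ℂ) * I) * ((Real.exp (-(b * |x|)) : ℝ) : ℂ) =
      (1 / (π : ℂ)) * ∫ t : ℝ, weilMellin h (1 / 2 + (t : ℂ) * I) *
        (((b / ((t - γ) ^ 2 + b ^ 2)) : ℝ) : ℂ) := by
  have hc : Continuous (weilMellin h) := continuous_weilMellin hh.1.continuous hh.2
  have hhalf : ((1 / 2 : ℝ) : ℂ) = 1 / 2 := by push_cast; rfl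
  -- the kernel `K t x = e^{-i(t-γ)x} e^{-b|x|}`
  set K : ℝ → ℝ → ℂ := fun t x =>
    cexp ((((-((t - γ) * x)) : ℝ) : ℂ) * I) * ((Real.exp (-(b * |x|)) : ℝ) : ℂ) with hK
  have hP : ∀ t : ℝ, (((b / ((t - γ) ^ 2 + b ^ 2)) : ℝ) : ℂ) = (1 / 2) * ∫ x : ℝ, K t x := by
    intro t
    rw [hK, stub_smearedWindowFormula_kernel hb γ t]
    push_cast
    ring
  have e1 : ∀ t : ℝ, weilMellin h (1 / 2 + (t : ℂ) * I) * (((b / ((t - γ) ^ 2 + b ^ 2)) : ℝ) : ℂ)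
      = ∫ x : ℝ, (1 / 2) * (weilMellin h (1 / 2 + (t : ℂ) * I) * K t x) := by
    intro t
    rw [hP t, ← integral_const_mul, ← integral_const_mul]
    congr 1 with x
    ring
  simp_rw [e1]
  -- Fubini
  have hint : Integrable (Function.uncurry fun (t : ℝ) (x : ℝ) =>
      (1 / 2) * (weilMellin h (1 / 2 + (t : ℂ) * I) * K t x)) (volume.prod volume) := by
    have h1 : Integrable (fun t : ℝ => weilMellin h (1 / 2 + (t : ℂ) * I)) := by
      have := integrable_weilMellin_vertical hh (1 / 2)
      rwa [hhalf] at this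
    have h2 : Integrable (fun x : ℝ => ((Real.exp (-(b * |x|)) : ℝ) : ℂ)) :=
      (integrable_exp_neg_mul_abs hb).ofReal
    refine Integrable.mono' (h1.mul_prod h2).norm ?_ (Eventually.of_forall fun p => ?_)
    · rw [hK]
      exact (by fun_prop : Continuous (Function.uncurry fun (t : ℝ) (x : ℝ) =>
        (1 / 2) * (weilMellin h (1 / 2 + (t : ℂ) * I) *
          (cexp ((((-((t - γ) * x)) : ℝ) : ℂ) * I) *
            ((Real.exp (-(b * |x|)) : ℝ) : ℂ))))).aestronglyMeasurable
    · obtain ⟨t, x⟩ := p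
      simp only [Function.uncurry_apply_pair, hK, norm_mul, Complex.norm_exp_ofReal_mul_I]
      have : ‖(1 / 2 : ℂ)‖ ≤ 1 := by norm_num
      have h0 : 0 ≤ ‖weilMellin h (1 / 2 + (t : ℂ) * I)‖ * ‖((Real.exp (-(b * |x|)) : ℝ) : ℂ)‖ := by
        positivity
      nlinarith
  rw [integral_integral_swap hint]
  -- the inner integral by Mellin inversion
  have inner : ∀ x : ℝ, (∫ t : ℝ, (1 / 2) * (weilMellin h (1 / 2 + (t : ℂ) * I) * K t x)) =
      (π : ℂ) * (h x * cexp (((γ * x : ℝ) : ℂ) * I) * ((Real.exp (-(b * |x|)) : ℝ) : ℂ)) := by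
    intro x
    have hinv := weilMellin_inversion hh (1 / 2) x
    rw [hhalf, sub_self, zero_mul, Complex.exp_zero, mul_one] at hinv
    have e2 : ∀ t : ℝ, (1 / 2) * (weilMellin h (1 / 2 + (t : ℂ) * I) * K t x) =
        weilMellin h (1 / 2 + (t : ℂ) * I) * cexp (-((t : ℂ) * I) * x) *
          ((1 / 2) * cexp (((γ * x : ℝ) : ℂ) * I) * ((Real.exp (-(b * |x|)) : ℝ) : ℂ)) := by
      intro t
      rw [hK]
      simp only
      have : cexp ((((-((t - γ) * x)) : ℝ) : ℂ) * I) =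
          cexp (-((t : ℂ) * I) * x) * cexp (((γ * x : ℝ) : ℂ) * I) := by
        rw [← Complex.exp_add]
        congr 1
        push_cast
        ring
      rw [this]
      ring
    simp_rw [e2]
    rw [integral_mul_const, hinv]
    ring
  simp_rw [inner]
  rw [integral_const_mul, ← mul_assoc, one_div,
    inv_mul_cancel₀ (Complex.ofReal_ne_zero.2 Real.pi_ne_zero), one_mul]

/-- **stub_smearedWindowFormula — the smeared window formula.** For a configuration
`(γ_k, b_k)` with `δ ≤ b_k ≤ B` (`δ > 0`), `Σ_k 1/(1+γ_k²) < ∞`, any real `L` and any Weil test `h`: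
`Σ_k ∫ h(x) e^{iγ_k x} e^{-b_k|x|} dx
  = (1/π) ∫ ĥ(1/2+it) (L + Σ_k b_k/((t-γ_k)²+b_k²)) dt - 2L h(0)` as a `HasSum`. Each term is
`(1/π) ∫ ĥ P_k` (`stub_smearedWindowFormula_atom`); the `L`-term is
`∫ ĥ(1/2+it) dt = 2π h(0)` (`integral_weilMellin_vertical`); the series is exchanged with the
integral by dominated convergence (`hasSum_integral_of_dominated_convergence`) with the majorant
`‖ĥ(1/2+it)‖ · 2B(1+δ⁻²)(1+t²)/(1+γ_k²)` (`stub_smearedWindowFormula_poisson_le`), integrable by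
the decay `(1+t²)‖ĥ(1/2+it)‖ ≤ C/(1+t²)` (`stub_smearedWindowFormula_decay`). -/
theorem stub_smearedWindowFormula :
    ∀ (γ b : ℕ → ℝ) (δ B L : ℝ), 0 < δ → (∀ k, δ ≤ b k ∧ b k ≤ B) →
      Summable (fun k => 1 / (1 + (γ k) ^ 2)) →
      ∀ h : ℝ → ℂ, IsWeilTest h →
        HasSum
          (fun k => ∫ x : ℝ, h x * cexp (((γ k * x : ℝ) : ℂ) * I) * ((Real.exp (-(b k * |x|)) : ℝ) : ℂ))
          ((1 / (π : ℂ)) * (∫ t : ℝ, weilMellin h (1 / 2 + (t : ℂ) * I) *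
              (((L + ∑' k, b k / ((t - γ k) ^ 2 + (b k) ^ 2) : ℝ)) : ℂ)) - 2 * L * h 0) := by
  intro γ b δ B L hδ hb hγ h hh
  have hbpos : ∀ k, 0 < b k := fun k => hδ.trans_le (hb k).1
  have hB : 0 ≤ B := (hbpos 0).le.trans (hb 0).2
  have hS₀ : 0 ≤ ∑' k, 1 / (1 + (γ k) ^ 2) := tsum_nonneg fun k => by positivity
  -- pointwise bounds on the Poisson kernels `P_k(t) = b_k / ((t - γ_k)² + b_k²)`
  have hP0 : ∀ k t, 0 ≤ b k / ((t - γ k) ^ 2 + (b k) ^ 2) := fun k t =>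
    stub_smearedWindowFormula_poisson_nonneg (hbpos k).le t (γ k)
  have hPc : ∀ k, Continuous fun t : ℝ => b k / ((t - γ k) ^ 2 + (b k) ^ 2) := fun k =>
    continuous_const.div (by fun_prop) fun t => by have := hbpos k; positivity
  obtain ⟨C₀, hC₀, hPle⟩ : ∃ C₀ : ℝ, 0 ≤ C₀ ∧ ∀ k t,
      b k / ((t - γ k) ^ 2 + (b k) ^ 2) ≤ C₀ * (1 + t ^ 2) * (1 / (1 + (γ k) ^ 2)) := by
    refine ⟨2 * B * (1 + (δ ^ 2)⁻¹), by positivity, fun k t => ?_⟩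
    rw [mul_one_div]
    exact stub_smearedWindowFormula_poisson_le hδ (hb k).1 (hb k).2 t (γ k)
  -- summability in `k` for each `t`, and the bound on the sum
  have hPsum : ∀ t, Summable (fun k => b k / ((t - γ k) ^ 2 + (b k) ^ 2)) := fun t =>
    Summable.of_nonneg_of_le (hP0 · t) (hPle · t) (hγ.mul_left _)
  have hSt0 : ∀ t, 0 ≤ ∑' k, b k / ((t - γ k) ^ 2 + (b k) ^ 2) := fun t => tsum_nonneg (hP0 · t)
  have hStle : ∀ t, ∑' k, b k / ((t - γ k) ^ 2 + (b k) ^ 2) ≤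
      C₀ * (1 + t ^ 2) * ∑' k, 1 / (1 + (γ k) ^ 2) := fun t =>
    calc ∑' k, b k / ((t - γ k) ^ 2 + (b k) ^ 2)
        ≤ ∑' k, C₀ * (1 + t ^ 2) * (1 / (1 + (γ k) ^ 2)) :=
          (hPsum t).tsum_le_tsum (hPle · t) (hγ.mul_left _)
      _ = C₀ * (1 + t ^ 2) * ∑' k, 1 / (1 + (γ k) ^ 2) := tsum_mul_left
  -- the transform on the critical line: continuity, integrability, decay
  have hFc : Continuous fun t : ℝ => weilMellin h (1 / 2 + (t : ℂ) * I) :=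
    (continuous_weilMellin hh.1.continuous hh.2).comp (by fun_prop)
  have hhalf : ((1 / 2 : ℝ) : ℂ) = 1 / 2 := by push_cast; rfl
  have hFi : Integrable fun t : ℝ => weilMellin h (1 / 2 + (t : ℂ) * I) := by
    have := integrable_weilMellin_vertical hh (1 / 2)
    rwa [hhalf] at this
  obtain ⟨C₁, hFdecay⟩ : ∃ C₁ : ℝ, ∀ t : ℝ,
      (1 + t ^ 2) * ‖weilMellin h (1 / 2 + (t : ℂ) * I)‖ ≤ C₁ / (1 + t ^ 2) :=
    ⟨_, fun t => stub_smearedWindowFormula_decay hh t⟩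
  -- the dominating function
  have hdom : Integrable fun t : ℝ => C₀ * C₁ * (∑' k, 1 / (1 + (γ k) ^ 2)) * (1 + t ^ 2)⁻¹ :=
    integrable_inv_one_add_sq.const_mul _
  have hdom_le : ∀ t : ℝ, ‖weilMellin h (1 / 2 + (t : ℂ) * I)‖ *
      (C₀ * (1 + t ^ 2) * ∑' k, 1 / (1 + (γ k) ^ 2)) ≤
        C₀ * C₁ * (∑' k, 1 / (1 + (γ k) ^ 2)) * (1 + t ^ 2)⁻¹ := by
    intro t
    calc ‖weilMellin h (1 / 2 + (t : ℂ) * I)‖ * (C₀ * (1 + t ^ 2) * ∑' k, 1 / (1 + (γ k) ^ 2))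
        = C₀ * (∑' k, 1 / (1 + (γ k) ^ 2)) *
            ((1 + t ^ 2) * ‖weilMellin h (1 / 2 + (t : ℂ) * I)‖) := by ring
      _ ≤ C₀ * (∑' k, 1 / (1 + (γ k) ^ 2)) * (C₁ / (1 + t ^ 2)) :=
          mul_le_mul_of_nonneg_left (hFdecay t) (mul_nonneg hC₀ hS₀)
      _ = C₀ * C₁ * (∑' k, 1 / (1 + (γ k) ^ 2)) * (1 + t ^ 2)⁻¹ := by ring
  -- dominated convergence: `Σ_k ∫ ĥ P_k = ∫ ĥ Σ_k P_k`
  have hmain : HasSum (fun k => ∫ t : ℝ, weilMellin h (1 / 2 + (t : ℂ) * I) *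
      (((b k / ((t - γ k) ^ 2 + (b k) ^ 2)) : ℝ) : ℂ))
      (∫ t : ℝ, weilMellin h (1 / 2 + (t : ℂ) * I) *
        (((∑' k, b k / ((t - γ k) ^ 2 + (b k) ^ 2)) : ℝ) : ℂ)) := by
    refine hasSum_integral_of_dominated_convergence
      (fun k t => ‖weilMellin h (1 / 2 + (t : ℂ) * I)‖ *
        (C₀ * (1 + t ^ 2) * (1 / (1 + (γ k) ^ 2))))
      (fun k => ?_) (fun k => Eventually.of_forall fun t => ?_) (Eventually.of_forall fun t => ?_)
      ?_ (Eventually.of_forall fun t => ?_)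
    · exact (hFc.mul (Complex.continuous_ofReal.comp (hPc k))).aestronglyMeasurable
    · rw [norm_mul, Complex.norm_real, Real.norm_of_nonneg (hP0 k t)]
      exact mul_le_mul_of_nonneg_left (hPle k t) (norm_nonneg _)
    · exact (hγ.mul_left _).mul_left _
    · have e : (fun t : ℝ => ∑' k, ‖weilMellin h (1 / 2 + (t : ℂ) * I)‖ *
          (C₀ * (1 + t ^ 2) * (1 / (1 + (γ k) ^ 2)))) = fun t : ℝ =>
          ‖weilMellin h (1 / 2 + (t : ℂ) * I)‖ *
            (C₀ * (1 + t ^ 2) * ∑' k, 1 / (1 + (γ k) ^ 2)) := by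
        funext t
        rw [tsum_mul_left, tsum_mul_left]
      rw [e]
      refine hdom.mono' (hFc.norm.mul (by fun_prop)).aestronglyMeasurable
        (Eventually.of_forall fun t => ?_)
      rw [Real.norm_of_nonneg (mul_nonneg (norm_nonneg _)
        (mul_nonneg (mul_nonneg hC₀ (by positivity)) hS₀))]
      exact hdom_le t
    · exact (Complex.hasSum_ofReal.2 (hPsum t).hasSum).mul_left _
  -- the smeared series against `ĥ` is integrable
  have hSm : AEStronglyMeasurable
      (fun t : ℝ => ∑' k, b k / ((t - γ k) ^ 2 + (b k) ^ 2)) volume := by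
    refine aestronglyMeasurable_of_tendsto_ae atTop
      (f := fun N t => ∑ k ∈ Finset.range N, b k / ((t - γ k) ^ 2 + (b k) ^ 2))
      (fun N => (continuous_finsetSum _ fun k _ => hPc k).aestronglyMeasurable)
      (Eventually.of_forall fun t => (hPsum t).hasSum.tendsto_sum_nat)
  have hFS : Integrable fun t : ℝ => weilMellin h (1 / 2 + (t : ℂ) * I) *
      (((∑' k, b k / ((t - γ k) ^ 2 + (b k) ^ 2)) : ℝ) : ℂ) := by
    refine hdom.mono'
      (hFc.aestronglyMeasurable.mul (Complex.continuous_ofReal.comp_aestronglyMeasurable hSm))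
      (Eventually.of_forall fun t => ?_)
    rw [norm_mul, Complex.norm_real, Real.norm_of_nonneg (hSt0 t)]
    exact (mul_le_mul_of_nonneg_left (hStle t) (norm_nonneg _)).trans (hdom_le t)
  -- the `L`-term: `∫ ĥ(1/2+it) dt = 2π h(0)`
  have hL : ∫ t : ℝ, weilMellin h (1 / 2 + (t : ℂ) * I) = 2 * π * h 0 := by
    have := integral_weilMellin_vertical hh (1 / 2)
    rwa [hhalf] at this
  have hsplit : (∫ t : ℝ, weilMellin h (1 / 2 + (t : ℂ) * I) *
      (((L + ∑' k, b k / ((t - γ k) ^ 2 + (b k) ^ 2) : ℝ)) : ℂ)) =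
      (L : ℂ) * (2 * π * h 0) + ∫ t : ℝ, weilMellin h (1 / 2 + (t : ℂ) * I) *
        (((∑' k, b k / ((t - γ k) ^ 2 + (b k) ^ 2)) : ℝ) : ℂ) := by
    have e : (fun t : ℝ => weilMellin h (1 / 2 + (t : ℂ) * I) *
        (((L + ∑' k, b k / ((t - γ k) ^ 2 + (b k) ^ 2) : ℝ)) : ℂ)) = fun t : ℝ =>
        (L : ℂ) * weilMellin h (1 / 2 + (t : ℂ) * I) + weilMellin h (1 / 2 + (t : ℂ) * I) *
          (((∑' k, b k / ((t - γ k) ^ 2 + (b k) ^ 2)) : ℝ) : ℂ) := by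
      funext t
      rw [Complex.ofReal_add]
      ring
    rw [e, integral_add (hFi.const_mul _) hFS, integral_const_mul, hL]
  -- assemble
  have eterm : (fun k => ∫ x : ℝ, h x * cexp (((γ k * x : ℝ) : ℂ) * I) *
      ((Real.exp (-(b k * |x|)) : ℝ) : ℂ)) = fun k => (1 / (π : ℂ)) *
        ∫ t : ℝ, weilMellin h (1 / 2 + (t : ℂ) * I) *
          (((b k / ((t - γ k) ^ 2 + (b k) ^ 2)) : ℝ) : ℂ) :=
    funext fun k => stub_smearedWindowFormula_atom hh (hbpos k) (γ k)
  have hπ : (π : ℂ) ≠ 0 := Complex.ofReal_ne_zero.2 Real.pi_ne_zero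
  have eval : (1 / (π : ℂ)) * (∫ t : ℝ, weilMellin h (1 / 2 + (t : ℂ) * I) *
      (((L + ∑' k, b k / ((t - γ k) ^ 2 + (b k) ^ 2) : ℝ)) : ℂ)) - 2 * L * h 0 =
      (1 / (π : ℂ)) * ∫ t : ℝ, weilMellin h (1 / 2 + (t : ℂ) * I) *
        (((∑' k, b k / ((t - γ k) ^ 2 + (b k) ^ 2)) : ℝ) : ℂ) := by
    rw [hsplit]
    generalize (∫ t : ℝ, weilMellin h (1 / 2 + (t : ℂ) * I) *
      (((∑' k, b k / ((t - γ k) ^ 2 + (b k) ^ 2)) : ℝ) : ℂ)) = X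
    field_simp
    ring
  rw [eterm, eval]
  exact hmain.mul_left _

end Summit.RiemannHypothesis.RiemannHypothesis.Theorems.SpectralTraceWindowTraceArch

end
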